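import Summits.CriticalPhenomena.PercolationContinuityZ3.Theorems.PercNearOneGluingNoHeavyLowerTailCovTauStarNReal
import Summits.CriticalPhenomena.PercolationContinuityZ3.Theorems.PercNearOneGluingNoHeavyLowerTailThreePointGamma
import Summits.CriticalPhenomena.PercolationContinuityZ3.Theorems.PercNearOneGluingNoHeavyLowerTailDualBHKBlock
import Literature.Probability.Percolation.ConditionalGladkovZimin
import Mathlib.Tactic.Linarith
import Mathlib.Tactic.Ring
import HarnessLib

/-!
# `NoHeavyLowerTail` (stmt-CriticalPhenomena-4575) — the BHK row of the pivotal refinement, kernel form, I: preliminaries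
# (BHK Thm 1.4 for two cluster functionals on the coordinates `D`; the dictionary "cells of `K ∪ S`" ↔ "`a`-star events";
# independence of the two `a`-stars off `{b ↔ c}`)

Support file (prover prim-gen-kcluster gen 43; `--supports stmt-CriticalPhenomena-4575`).  No named facts, no sorries,
one auxiliary event (`{S : Finset (Sym2 V) | ∃ y ∈ cl K x, s(a, y) ∈ S}`: some pair of the configuration joins `a` to the `K`-cluster of `x`).  The theorem itself
(`PivotalBHK.bhkRow_PrW`) is in part II, `…PivotalBHKRow.lean`; the plan of the proof is described there and summarised here.

Three-point cells of the finitary weighted cube `PrW D p` (coordinates = the pairs `D`, terminals `a b c`):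
`q = P(a|b|c)` (`Qe a b c`), `u_b = P(ac|b) = PrW(conn a c ∩ (conn a b)ᶜ)`, `u_c = P(ab|c) = PrW(conn a b ∩ (conn a c)ᶜ)`,
and the PIVOTAL cell `T_a = n_a = P(abc ∧ b ≁ c once the pairs at a are closed)` (`conn a b ∩ conn a c ∩ pivEv a b c`,
prim-ineq-gen-2's `n`, prim-cert-2's `ThreePointGamma.pivEv`).

**Theorem (BHK row, `bhkRow_PrW`).**  For `a ≠ b`, `a ≠ c`:  `PrW(Qe a b c) · PrW(T_a) ≤ PrW(U_b) · PrW(U_c)`, i.e. `q · n_a ≤ u_b · u_c`.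

This is the percolation-law form of van den Berg–Häggström–Kahn's Theorem 1.4 [cite: VandenbergHaggstromKahn2005, Thm. 1.4 (p. 7)
and eq. (2) (p. 2)] ("given `s ↮ t`, increasing functions of `C_s` and of `C_t` are negatively correlated"), applied on the
coordinates `D ∖ touch{a}` (the world without the pairs at `a`) to the two increasing cluster functionals
`F(C_b) = P(some open pair at a lands in C_b)`, `G(C_c) = P(some open pair at a lands in C_c)`: integrating out the pairs at `a`
(block Fubini `CondGZ.ED_union`), `T_a = E[1{b↮c} F G]`, `u_c = E[1{b↮c} F (1−G)]`, `u_b = E[1{b↮c} (1−F) G]`,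
`q = E[1{b↮c}(1−F)(1−G)]` — the products because, given `b ↮ c` off `a`, the `a`-stars into the two clusters are disjoint
sets of coordinates — and then `u_b u_c − q T_a = E[1{b↮c}F]·E[1{b↮c}G] − E[1{b↮c}]·E[1{b↮c}FG] ≥ 0` is exactly Theorem 1.4
(tree: `BHK2006_twoSetConditionalAssociation.negCorrelation`, Literature, proved).  In the law-level files of the cubic programme
this row is the hypothesis `0 ≤ SBHK` (`CubicThreePointApex.SBHK`, "[folklore] BHK 2006 Thm 1.4"); here it is a kernel theorem in the
route's `PrW` vocabulary, next to its dual `DualBHK.dualBHK` (`t · n′_a ≤ u_b · u_c`).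
-/

noncomputable section

namespace Summit.CriticalPhenomena.PercolationContinuityZ3.Theorems

namespace PivotalBHK

open Finset MeasureTheory Literature.Probability.Percolation Literature.Probability.Percolation.DecisionTree
open Literature.Probability.LatticeModels (prodBernoulli)
open Gladkov ThreePointGamma CovTauStarN ThreePointLB
open scoped Classical

variable {V : Type*} [Fintype V] [DecidableEq V]

/-! ### BHK Theorem 1.4 for two cluster functionals, finitary form on the coordinates `D` -/

/-- **BHK Theorem 1.4, finitary, two functionals**: on the coordinates `D` with weights `p ∈ [0,1]`, for `Ψ, Φ` increasing
functions of edge sets, `P(b↮c)·E[Ψ(C_b)Φ(C_c); b↮c] ≤ E[Ψ(C_b); b↮c]·E[Φ(C_c); b↮c]`.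
[cite: VandenbergHaggstromKahn2005, Thm. 1.4 (p. 7)] -/
theorem bhk14_two_ED (D : Finset (Sym2 V)) {p : Sym2 V → ℝ} (hp0 : ∀ e, 0 ≤ p e) (hp1 : ∀ e, p e ≤ 1)
    (b c : V) (Ψ Φ : Set (Sym2 V) → ℝ) (hΨ : Monotone Ψ) (hΦ : Monotone Φ) :
    ED D p (fun K => 1 - hr b c K) * ED D p (fun K => (1 - hr b c K) * (fcl Ψ b K * fcl Φ c K)) ≤
      ED D p (fun K => (1 - hr b c K) * fcl Ψ b K) * ED D p (fun K => (1 - hr b c K) * fcl Φ c K) := by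
  set w : Sym2 V → unitInterval := fun e => if e ∈ D then ⟨max 0 (min 1 (p e)), by
    exact ⟨le_max_left _ _, max_le zero_le_one (min_le_left _ _)⟩⟩ else 0 with hw
  have hwD : ∀ e ∈ D, ((w e : unitInterval) : ℝ) = p e := fun e he => by
    simp only [hw, if_pos he]
    rw [min_eq_right (hp1 e), max_eq_right (hp0 e)]
  have hwD' : ∀ e ∉ D, ((w e : unitInterval) : ℝ) = 0 := fun e he => by simp only [hw, if_neg he]; rfl
  have hED : ∀ φ : Finset (Sym2 V) → ℝ, ED Finset.univ (fun e => (w e : ℝ)) φ = ED D p φ :=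
    fun φ => ED_univ_eq_ED_of_zero D p _ hwD hwD' φ
  have key := BHK2006_twoSetConditionalAssociation.negCorrelation w {b} {c} Ψ Φ hΨ hΦ
  set D0 : Set (Set (Sym2 V)) := {ω | ∀ s ∈ ({b} : Set V), ∀ t ∈ ({c} : Set V), ¬ (openGraph ω).Reachable s t}
    with hD0
  have hind : ∀ K : Finset (Sym2 V), ind D0 (↑K : Set (Sym2 V)) = 1 - hr b c K := by
    intro K
    unfold hr
    by_cases h : (openGraph (↑K : Set (Sym2 V))).Reachable b c
    · rw [ind_of_mem (show K ∈ {L : Finset (Sym2 V) | (openGraph (↑L : Set (Sym2 V))).Reachable b c} from h),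
        ind_of_not_mem (show (↑K : Set (Sym2 V)) ∉ D0 from fun hK => hK b rfl c rfl h)]
      ring
    · rw [ind_of_not_mem (show K ∉ {L : Finset (Sym2 V) | (openGraph (↑L : Set (Sym2 V))).Reachable b c} from h),
        ind_of_mem (show (↑K : Set (Sym2 V)) ∈ D0 from fun s hs t ht => by
          rw [Set.mem_singleton_iff] at hs ht; rw [hs, ht]; exact h)]
      ring
  simp only [Set.biUnion_singleton] at key
  rw [measureReal_eq_ED, setIntegral_eq_ED, setIntegral_eq_ED, setIntegral_eq_ED, hED, hED, hED, hED] at key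
  have e1 : ED D p (fun K => ind D0 (↑K : Set (Sym2 V))) = ED D p (fun K => 1 - hr b c K) :=
    ED_congr_on D p fun K _ => hind K
  have e2 : ED D p (fun K => ind D0 (↑K : Set (Sym2 V)) *
      (Ψ (openEdgeCluster (↑K : Set (Sym2 V)) b) * Φ (openEdgeCluster (↑K : Set (Sym2 V)) c))) =
      ED D p (fun K => (1 - hr b c K) * (fcl Ψ b K * fcl Φ c K)) :=
    ED_congr_on D p fun K _ => by rw [hind, fcl, fcl]
  have e3 : ED D p (fun K => ind D0 (↑K : Set (Sym2 V)) * Ψ (openEdgeCluster (↑K : Set (Sym2 V)) b)) =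
      ED D p (fun K => (1 - hr b c K) * fcl Ψ b K) :=
    ED_congr_on D p fun K _ => by rw [hind, fcl]
  have e4 : ED D p (fun K => ind D0 (↑K : Set (Sym2 V)) * Φ (openEdgeCluster (↑K : Set (Sym2 V)) c)) =
      ED D p (fun K => (1 - hr b c K) * fcl Φ c K) :=
    ED_congr_on D p fun K _ => by rw [hind, fcl]
  rw [e1, e2, e3, e4] at key
  linarith

/-! ### Clusters in a configuration without pairs at `a`, and the `a`-stars -/

section Clusters

variable {a b c : V}

/-- In a configuration with no pair at `a`, the cluster of a vertex `x ≠ a` misses `a`. [folklore] -/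
theorem not_mem_cl_of_noPair {K : Finset (Sym2 V)} (hK : ∀ e ∈ K, a ∉ e) {x : V} (hx : x ≠ a) : a ∉ cl K x := by
  intro h
  obtain ⟨wlk⟩ := mem_cl.1 h
  have hC : ∀ u v, u ∈ (Finset.univ.filter fun v : V => v ≠ a) →
      (openGraph (↑K : Set (Sym2 V))).Adj u v → v ∈ (Finset.univ.filter fun v : V => v ≠ a) := by
    intro u v _ huv
    rw [Finset.mem_filter]
    refine ⟨Finset.mem_univ _, fun hva => ?_⟩
    rw [adj_iff] at huv
    exact hK _ huv.1 (hva ▸ Sym2.mem_mk_right u v)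
  have := mem_of_walk hC wlk (by rw [Finset.mem_filter]; exact ⟨Finset.mem_univ _, hx⟩)
  rw [Finset.mem_filter] at this
  exact this.2 rfl

/-- **The cluster of `x` in `K ∪ S` (no pair of `K` at `a`, every pair of `S` at `a`)**: if no `S`-pair joins `a` to `cl K x`
then `cl (K ∪ S) x = cl K x` stays away from `a`; precisely `cl (K ∪ S) x ⊆ cl K x`. [this work] -/
theorem cl_union_subset_of_not_starHit {K S : Finset (Sym2 V)} (hK : ∀ e ∈ K, a ∉ e) (hS : ∀ e ∈ S, a ∈ e)
    {x : V} (hx : x ≠ a) (hhit : S ∉ {S : Finset (Sym2 V) | ∃ y ∈ cl K x, s(a, y) ∈ S}) : cl (K ∪ S) x ⊆ cl K x := by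
  intro v hv
  obtain ⟨wlk⟩ := mem_cl.1 hv
  have hxa : a ∉ cl K x := not_mem_cl_of_noPair hK hx
  have hC : ∀ u v, u ∈ cl K x → (openGraph (↑(K ∪ S) : Set (Sym2 V))).Adj u v → v ∈ cl K x := by
    intro u v hu huv
    rw [adj_iff, Finset.mem_union] at huv
    rcases huv.1 with he | he
    · exact mem_cl_of_adj hu (adj_iff.2 ⟨he, huv.2⟩)
    · -- a pair of `S` contains `a`; `u ≠ a` (since `u ∈ cl K x ∌ a`), so `v = a` and the pair hits the cluster
      have hua : u ≠ a := fun h => hxa (h ▸ hu)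
      have hva : v = a := by
        have := hS _ he
        rcases Sym2.mem_iff.1 this with h | h
        · exact absurd h.symm hua
        · exact h.symm
      exact absurd ⟨u, hu, by rw [Sym2.eq_swap, ← hva]; exact he⟩ hhit
  exact mem_of_walk hC wlk (mem_cl_self K x)

/-- Conversely an `S`-pair into `cl K x` joins `a` to `x` in `K ∪ S`. [this work] -/
theorem mem_cl_union_of_starHit {K S : Finset (Sym2 V)} {x : V} (hhit : S ∈ {S : Finset (Sym2 V) | ∃ y ∈ cl K x, s(a, y) ∈ S}) :
    a ∈ cl (K ∪ S) x := by
  obtain ⟨y, hy, hyS⟩ := hhit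
  have hy' : y ∈ cl (K ∪ S) x := cl_mono Finset.subset_union_left x hy
  by_cases hya : y = a
  · exact hya ▸ hy'
  · exact mem_cl_of_adj hy' (adj_iff.2 ⟨Finset.mem_union_right _ (by rw [Sym2.eq_swap]; exact hyS), hya⟩)

end Clusters

/-! ### The pointwise dictionary: cells of `K' ∪ S` (`K'` off `a`, `S` at `a`) in terms of the two `a`-star events -/

section Dictionary

variable {a b c : V} {K S : Finset (Sym2 V)}

/-- `K ∪ S ∈ conn a x ↔ S ∈ {S : Finset (Sym2 V) | ∃ y ∈ cl K x, s(a, y) ∈ S}` (for `K` off `a`, `S` at `a`, `x ≠ a`). [this work] -/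
theorem union_mem_conn_iff (hK : ∀ e ∈ K, a ∉ e) (hS : ∀ e ∈ S, a ∈ e) {x : V} (hx : x ≠ a) :
    K ∪ S ∈ conn a x ↔ S ∈ {S : Finset (Sym2 V) | ∃ y ∈ cl K x, s(a, y) ∈ S} := by
  constructor
  · intro h
    by_contra hhit
    have hsub := cl_union_subset_of_not_starHit hK hS hx hhit
    have hax : a ∈ cl (K ∪ S) x := mem_cl_comm.1 (mem_conn_iff_mem_cl.1 h)
    exact not_mem_cl_of_noPair hK hx (hsub hax)
  · intro hhit
    exact mem_conn_iff_mem_cl.2 (mem_cl_comm.1 (mem_cl_union_of_starHit hhit))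

/-- Removing the pairs at `a` from `K ∪ S` leaves `K`. [this work] -/
theorem union_sdiff_touch (hK : ∀ e ∈ K, a ∉ e) (hS : ∀ e ∈ S, a ∈ e) : (K ∪ S) \ touch {a} = K := by
  ext e
  simp only [Finset.mem_sdiff, Finset.mem_union, mem_touch, Finset.mem_singleton, exists_eq_left]
  constructor
  · rintro ⟨h | h, hna⟩
    · exact h
    · exact absurd (hS e h) hna
  · exact fun h => ⟨Or.inl h, hK e h⟩

/-- `K ∪ S ∈ pivEv a b c ↔ c ∉ cl K b`. [this work] -/
theorem union_mem_pivEv_iff (hK : ∀ e ∈ K, a ∉ e) (hS : ∀ e ∈ S, a ∈ e) :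
    K ∪ S ∈ pivEv a b c ↔ c ∉ cl K b := by
  rw [mem_pivEv, union_sdiff_touch hK hS]

/-- `K ∪ S ∈ conn b c ↔ c ∈ cl K b ∨ (S ∈ {S : Finset (Sym2 V) | ∃ y ∈ cl K b, s(a, y) ∈ S} ∧ S ∈ {S : Finset (Sym2 V) | ∃ y ∈ cl K c, s(a, y) ∈ S})` (for `b, c ≠ a`). [this work] -/
theorem union_mem_conn_bc_iff (hK : ∀ e ∈ K, a ∉ e) (hS : ∀ e ∈ S, a ∈ e) (hab : b ≠ a) (hac : c ≠ a) :
    K ∪ S ∈ conn b c ↔ c ∈ cl K b ∨ (S ∈ {S : Finset (Sym2 V) | ∃ y ∈ cl K b, s(a, y) ∈ S} ∧ S ∈ {S : Finset (Sym2 V) | ∃ y ∈ cl K c, s(a, y) ∈ S}) := by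
  constructor
  · intro h
    by_contra hn
    rw [not_or, not_and_or] at hn
    obtain ⟨hcb, hn⟩ := hn
    have hc : c ∈ cl (K ∪ S) b := mem_conn_iff_mem_cl.1 h
    rcases hn with hb' | hc'
    · exact hcb (cl_union_subset_of_not_starHit hK hS hab hb' hc)
    · have hb : b ∈ cl (K ∪ S) c := mem_cl_comm.1 hc
      exact hcb (mem_cl_comm.1 (cl_union_subset_of_not_starHit hK hS hac hc' hb))
  · rintro (h | ⟨hb, hc⟩)
    · exact mem_conn_iff_mem_cl.2 (cl_mono Finset.subset_union_left b h)
    · have h1 : a ∈ cl (K ∪ S) b := mem_cl_union_of_starHit hb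
      have h2 : a ∈ cl (K ∪ S) c := mem_cl_union_of_starHit hc
      exact mem_conn_iff_mem_cl.2 (mem_cl.2 ((mem_cl.1 h1).trans (mem_cl.1 h2).symm))

/-- The indicator of `{b ↔ c}` on a configuration `K`: `hr b c K = 1` iff `c ∈ cl K b`. [folklore] -/
theorem hr_eq_ite (b c : V) (K : Finset (Sym2 V)) : hr b c K = if c ∈ cl K b then 1 else 0 := by
  unfold hr
  by_cases h : c ∈ cl K b
  · rw [if_pos h, ind_of_mem (show K ∈ {L : Finset (Sym2 V) | (openGraph (↑L : Set (Sym2 V))).Reachable b c} from mem_cl.1 h)]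
  · rw [if_neg h, ind_of_not_mem (show K ∉ {L : Finset (Sym2 V) | (openGraph (↑L : Set (Sym2 V))).Reachable b c} from
      fun h' => h (mem_cl.2 h'))]

/-- **Dictionary, pivotal cell**: `1[K ∪ S ∈ T_a] = (1 − 1{b↔c}(K)) · 1[S hits cl K b] · 1[S hits cl K c]`. [this work] -/
theorem ind_Ta_union (hK : ∀ e ∈ K, a ∉ e) (hS : ∀ e ∈ S, a ∈ e) (hab : b ≠ a) (hac : c ≠ a) :
    ind (conn a b ∩ conn a c ∩ pivEv a b c) (K ∪ S) =
      (1 - hr b c K) * (ind ({S : Finset (Sym2 V) | ∃ y ∈ cl K b, s(a, y) ∈ S}) S * ind ({S : Finset (Sym2 V) | ∃ y ∈ cl K c, s(a, y) ∈ S}) S) := by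
  rw [hr_eq_ite]
  by_cases hcb : c ∈ cl K b
  · rw [if_pos hcb, sub_self, zero_mul, ind_of_not_mem]
    rintro ⟨-, h3⟩
    exact (union_mem_pivEv_iff hK hS).1 h3 hcb
  · rw [if_neg hcb, sub_zero, one_mul]
    by_cases hb : S ∈ {S : Finset (Sym2 V) | ∃ y ∈ cl K b, s(a, y) ∈ S} <;> by_cases hc : S ∈ {S : Finset (Sym2 V) | ∃ y ∈ cl K c, s(a, y) ∈ S}
    · rw [ind_of_mem hb, ind_of_mem hc, one_mul, ind_of_mem]
      exact ⟨⟨(union_mem_conn_iff hK hS hab).2 hb, (union_mem_conn_iff hK hS hac).2 hc⟩, (union_mem_pivEv_iff hK hS).2 hcb⟩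
    · rw [ind_of_mem hb, ind_of_not_mem hc, mul_zero, ind_of_not_mem]
      rintro ⟨⟨-, h2⟩, -⟩; exact hc ((union_mem_conn_iff hK hS hac).1 h2)
    · rw [ind_of_not_mem hb, zero_mul, ind_of_not_mem]
      rintro ⟨⟨h1, -⟩, -⟩; exact hb ((union_mem_conn_iff hK hS hab).1 h1)
    · rw [ind_of_not_mem hb, zero_mul, ind_of_not_mem]
      rintro ⟨⟨h1, -⟩, -⟩; exact hb ((union_mem_conn_iff hK hS hab).1 h1)

/-- **Dictionary, `ab|c`**: `1[K ∪ S ∈ U_c] = (1 − 1{b↔c}(K)) · 1[S hits cl K b] · (1 − 1[S hits cl K c])`. [this work] -/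
theorem ind_Uc_union (hK : ∀ e ∈ K, a ∉ e) (hS : ∀ e ∈ S, a ∈ e) (hab : b ≠ a) (hac : c ≠ a) :
    ind (conn a b ∩ (conn a c)ᶜ) (K ∪ S) =
      (1 - hr b c K) * (ind ({S : Finset (Sym2 V) | ∃ y ∈ cl K b, s(a, y) ∈ S}) S * (1 - ind ({S : Finset (Sym2 V) | ∃ y ∈ cl K c, s(a, y) ∈ S}) S)) := by
  rw [hr_eq_ite]
  by_cases hcb : c ∈ cl K b
  · rw [if_pos hcb, sub_self, zero_mul, ind_of_not_mem]
    rintro ⟨h1, h2⟩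
    have hb : S ∈ {S : Finset (Sym2 V) | ∃ y ∈ cl K b, s(a, y) ∈ S} := (union_mem_conn_iff hK hS hab).1 h1
    have : K ∪ S ∈ conn b c := (union_mem_conn_bc_iff hK hS hab hac).2 (Or.inl hcb)
    -- a ~ b ~ c gives a ~ c
    exact h2 (mem_conn_iff_mem_cl.2 (mem_cl.2 ((mem_cl.1 (mem_conn_iff_mem_cl.1 h1)).trans (mem_cl.1 (mem_conn_iff_mem_cl.1 this)))))
  · rw [if_neg hcb, sub_zero, one_mul]
    by_cases hb : S ∈ {S : Finset (Sym2 V) | ∃ y ∈ cl K b, s(a, y) ∈ S} <;> by_cases hc : S ∈ {S : Finset (Sym2 V) | ∃ y ∈ cl K c, s(a, y) ∈ S}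
    · rw [ind_of_mem hb, ind_of_mem hc, sub_self, mul_zero, ind_of_not_mem]
      rintro ⟨-, h2⟩; exact h2 ((union_mem_conn_iff hK hS hac).2 hc)
    · rw [ind_of_mem hb, ind_of_not_mem hc, sub_zero, one_mul, ind_of_mem]
      exact ⟨(union_mem_conn_iff hK hS hab).2 hb, fun h2 => hc ((union_mem_conn_iff hK hS hac).1 h2)⟩
    · rw [ind_of_not_mem hb, zero_mul, ind_of_not_mem]
      rintro ⟨h1, -⟩; exact hb ((union_mem_conn_iff hK hS hab).1 h1)
    · rw [ind_of_not_mem hb, zero_mul, ind_of_not_mem]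
      rintro ⟨h1, -⟩; exact hb ((union_mem_conn_iff hK hS hab).1 h1)

/-- **Dictionary, `a|b|c`**: `1[K ∪ S ∈ Q] = (1 − 1{b↔c}(K)) · (1 − 1[S hits cl K b]) · (1 − 1[S hits cl K c])`. [this work] -/
theorem ind_Q_union (hK : ∀ e ∈ K, a ∉ e) (hS : ∀ e ∈ S, a ∈ e) (hab : b ≠ a) (hac : c ≠ a) :
    ind ((conn a b)ᶜ ∩ (conn a c)ᶜ ∩ (conn b c)ᶜ) (K ∪ S) =
      (1 - hr b c K) * ((1 - ind ({S : Finset (Sym2 V) | ∃ y ∈ cl K b, s(a, y) ∈ S}) S) * (1 - ind ({S : Finset (Sym2 V) | ∃ y ∈ cl K c, s(a, y) ∈ S}) S)) := by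
  rw [hr_eq_ite]
  by_cases hcb : c ∈ cl K b
  · rw [if_pos hcb, sub_self, zero_mul, ind_of_not_mem]
    rintro ⟨-, h3⟩
    exact h3 ((union_mem_conn_bc_iff hK hS hab hac).2 (Or.inl hcb))
  · rw [if_neg hcb, sub_zero, one_mul]
    by_cases hb : S ∈ {S : Finset (Sym2 V) | ∃ y ∈ cl K b, s(a, y) ∈ S} <;> by_cases hc : S ∈ {S : Finset (Sym2 V) | ∃ y ∈ cl K c, s(a, y) ∈ S}
    · rw [ind_of_mem hb, sub_self, zero_mul, ind_of_not_mem]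
      rintro ⟨⟨h1, -⟩, -⟩; exact h1 ((union_mem_conn_iff hK hS hab).2 hb)
    · rw [ind_of_mem hb, sub_self, zero_mul, ind_of_not_mem]
      rintro ⟨⟨h1, -⟩, -⟩; exact h1 ((union_mem_conn_iff hK hS hab).2 hb)
    · rw [ind_of_not_mem hb, ind_of_mem hc, sub_self, mul_zero, ind_of_not_mem]
      rintro ⟨⟨-, h2⟩, -⟩; exact h2 ((union_mem_conn_iff hK hS hac).2 hc)
    · rw [ind_of_not_mem hb, ind_of_not_mem hc, sub_zero, mul_one, ind_of_mem]
      refine ⟨⟨fun h1 => hb ((union_mem_conn_iff hK hS hab).1 h1), fun h2 => hc ((union_mem_conn_iff hK hS hac).1 h2)⟩,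
        fun h3 => ?_⟩
      rcases (union_mem_conn_bc_iff hK hS hab hac).1 h3 with h | ⟨h, -⟩
      · exact hcb h
      · exact hb h

end Dictionary

/-! ### Integrating out the pairs at `a`: the two star events are independent off `{b ↔ c}` -/

section Stars

variable (Da : Finset (Sym2 V)) (p : Sym2 V → ℝ) {a b c : V} (K : Finset (Sym2 V))

omit [Fintype V] in
/-- Mass of an intersection of two events living on complementary coordinate blocks is the product of the masses. [folklore] -/
theorem PrW_inter_of_local {A B : Finset (Sym2 V)} (hAB : Disjoint A B) (p : Sym2 V → ℝ) {X Y : Set (Finset (Sym2 V))}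
    (hX : ∀ T, T ⊆ A → ∀ R, R ⊆ B → (T ∪ R ∈ X ↔ T ∈ X)) (hY : ∀ T, T ⊆ A → ∀ R, R ⊆ B → (T ∪ R ∈ Y ↔ R ∈ Y)) :
    PrW (A ∪ B) p (X ∩ Y) = PrW A p X * PrW B p Y := by
  rw [DualBHK.PrW_union_eq_sum hAB, PrW_eq_sum_ind, PrW_eq_sum_ind, Finset.sum_mul (s := A.powerset)]
  refine Finset.sum_congr rfl fun T hT => ?_
  have inner : ∑ R ∈ B.powerset, wtW B p R * ind (X ∩ Y) (T ∪ R) =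
      ind X T * ∑ R ∈ B.powerset, wtW B p R * ind Y R := by
    rw [Finset.mul_sum (s := B.powerset)]
    refine Finset.sum_congr rfl fun R hR => ?_
    have h1 := hX T (Finset.mem_powerset.1 hT) R (Finset.mem_powerset.1 hR)
    have h2 := hY T (Finset.mem_powerset.1 hT) R (Finset.mem_powerset.1 hR)
    have e1 : ind X (T ∪ R) = ind X T := by
      by_cases h : T ∈ X
      · rw [ind_of_mem h, ind_of_mem (h1.2 h)]
      · rw [ind_of_not_mem h, ind_of_not_mem (fun h' => h (h1.1 h'))]
    have e2 : ind Y (T ∪ R) = ind Y R := by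
      by_cases h : R ∈ Y
      · rw [ind_of_mem h, ind_of_mem (h2.2 h)]
      · rw [ind_of_not_mem h, ind_of_not_mem (fun h' => h (h2.1 h'))]
    rw [BHK2006.ind_inter, e1, e2]; ring
  rw [inner]; ring

/-- **Independence of the two `a`-stars**: if `cl K b` and `cl K c` are disjoint (`c ∉ cl K b`) and `K` has no pair at `a` (so that
`a` is in neither cluster, `b, c ≠ a`), then on any block `Da` of pairs at `a`
`PrW({S : Finset (Sym2 V) | ∃ y ∈ cl K b, s(a, y) ∈ S} ∩ {S : Finset (Sym2 V) | ∃ y ∈ cl K c, s(a, y) ∈ S}) = PrW({S : Finset (Sym2 V) | ∃ y ∈ cl K b, s(a, y) ∈ S}) · PrW({S : Finset (Sym2 V) | ∃ y ∈ cl K c, s(a, y) ∈ S})`. [this work] -/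
theorem PrW_starHit_inter (hK : ∀ e ∈ K, a ∉ e) (hab : b ≠ a) (hcb : c ∉ cl K b) :
    PrW Da p ({S : Finset (Sym2 V) | ∃ y ∈ cl K b, s(a, y) ∈ S} ∩ {S : Finset (Sym2 V) | ∃ y ∈ cl K c, s(a, y) ∈ S}) = PrW Da p ({S : Finset (Sym2 V) | ∃ y ∈ cl K b, s(a, y) ∈ S}) * PrW Da p ({S : Finset (Sym2 V) | ∃ y ∈ cl K c, s(a, y) ∈ S}) := by
  set A := Da.filter (fun e => ∃ y ∈ cl K b, e = s(a, y)) with hA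
  set B := Da.filter (fun e => ¬ ∃ y ∈ cl K b, e = s(a, y)) with hB
  have hAB : Disjoint A B := Finset.disjoint_filter_filter_not Da Da _
  have hDa : A ∪ B = Da := Finset.filter_union_filter_not_eq _ Da
  have hab' : a ∉ cl K b := not_mem_cl_of_noPair hK hab
  -- locality of the two events
  have hX : ∀ T, T ⊆ A → ∀ R, R ⊆ B → (T ∪ R ∈ {S : Finset (Sym2 V) | ∃ y ∈ cl K b, s(a, y) ∈ S} ↔ T ∈ {S : Finset (Sym2 V) | ∃ y ∈ cl K b, s(a, y) ∈ S}) := by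
    intro T hT R hR
    simp only [Set.mem_setOf_eq, Finset.mem_union]
    constructor
    · rintro ⟨y, hy, h | h⟩
      · exact ⟨y, hy, h⟩
      · have := (Finset.mem_filter.1 (hR h)).2
        exact absurd ⟨y, hy, rfl⟩ this
    · rintro ⟨y, hy, h⟩; exact ⟨y, hy, Or.inl h⟩
  have hY : ∀ T, T ⊆ A → ∀ R, R ⊆ B → (T ∪ R ∈ {S : Finset (Sym2 V) | ∃ y ∈ cl K c, s(a, y) ∈ S} ↔ R ∈ {S : Finset (Sym2 V) | ∃ y ∈ cl K c, s(a, y) ∈ S}) := by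
    intro T hT R hR
    simp only [Set.mem_setOf_eq, Finset.mem_union]
    constructor
    · rintro ⟨z, hz, h | h⟩
      · obtain ⟨y, hy, hyz⟩ := (Finset.mem_filter.1 (hT h)).2
        rw [Sym2.eq_iff] at hyz
        rcases hyz with ⟨-, hzy⟩ | ⟨hay, -⟩
        · rw [hzy] at hz
          exact absurd (mem_cl.2 ((mem_cl.1 hy).trans (mem_cl.1 hz).symm)) hcb
        · exact absurd (by rw [hay]; exact hy) hab'
      · exact ⟨z, hz, h⟩
    · rintro ⟨z, hz, h⟩; exact ⟨z, hz, Or.inr h⟩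
  rw [← hDa, PrW_inter_of_local hAB p hX hY, DualBHK.PrW_local hAB p hY]
  congr 1
  rw [Finset.union_comm]
  exact (DualBHK.PrW_local hAB.symm p (fun T hT R hR => by rw [Finset.union_comm]; exact hX R hR T hT)).symm

end Stars

end PivotalBHK

end Summit.CriticalPhenomena.PercolationContinuityZ3.Theorems

end
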